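import Summits.CriticalPhenomena.SAWScalingLimit.Theses.SAWLoopFugacityFlow
import Literature.Barriers.CriticalPhenomena.SupercriticalSAWSpaceFillingUnconditional

/-!
# Negative-side results for the crux `SAWLoopFugacityFlow.SimpleSubseqLimits` (stmt-CriticalPhenomena-4982):
CRITICALITY IS LOAD-BEARING — at every fugacity `x > x_c` the crux holds only vacuously
(work-file §9).

`SimpleSubseqLimitsAt x` is the crux with the critical law `SAW.law` (weights `x_c^{|γ|}`) replaced
by the parameter-`x` law `SupercriticalSAW.lawAt x` (weights `x^{|γ|}`, Duminil-Copin–Kozma–Yadin);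
at `x = x_c` it is the crux, definitionally. For `x > x_c`, Theorem 1 of Duminil-Copin–Kozma–Yadin
(PROVED in the tree, `DKY2014_thm1_holds`) makes the laws in `(𝔻; 1, -1)` with closest-site
endpoints weakly space-filling, and the tree's portmanteau mechanism (`ae_subset_range_of_tendstoLaw`,
run on a sequence of meshes reindexed as a mesh family) shows that EVERY subsequential weak limit is
carried by curves whose trace contains the open disc — hence by NO simple curve (a simple curve covers
no open set). So `SimpleSubseqLimitsAt x` is false as soon as one supercritical subsequential limit
exists (expected: the conjectural limit is SLE₈), and can hold only vacuously
(`no_supercritical_limit_of_simpleSubseqLimitsAt`). Any proof of the crux must use `x = x_c`.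

Refuter `cdisprove` (standing adversary); the full indexed work file is
`Summits/CriticalPhenomena/SAWScalingLimit/Cruxes/SimpleSubseqLimits/Disproof.lean`.
-/

noncomputable section

open MeasureTheory Filter Topology Set Metric
open Literature.Probability.RandomPlanarGeometry Literature.Probability.RandomPlanarGeometry.SAW
open Literature.Probability.LatticeModels
open Literature.Barriers.CriticalPhenomena Literature.Barriers.CriticalPhenomena.SupercriticalSAW
open scoped ENNReal NNReal BoundedContinuousFunction

namespace Summit.CriticalPhenomena.SAWScalingLimit.Theorems.SimpleSubseqLimits.Negative

open Summit.CriticalPhenomena.SAWScalingLimit.Theses.SAWLoopFugacityFlow (SimpleSubseqLimits)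

/-- The crux at fugacity `x`: `SAW.law` replaced by the parameter-`x` law `lawAt x`, everything
else verbatim — a one-parameter family of statements through the route item (at `x = x_c`),
not a literature fact. -/
def SimpleSubseqLimitsAt (x : ℝ) : Prop :=
  ∀ (D : DobrushinDomain) (a b : ℝ → Site 2), IsEndpointApprox D a b →
    ∀ (s : ℕ → ℝ) (ν : Measure (CurveClass ℂ)), Tendsto s atTop (𝓝[>] (0 : ℝ)) →
      IsProbabilityMeasure ν →
      (∀ f : CurveClass ℂ →ᵇ ℝ,
        Tendsto (fun n => ∫ γ, f γ.curve ∂(lawAt x D.carrier (s n) (a (s n)) (b (s n)))) atTop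
          (𝓝 (∫ x, f x ∂ν))) →
      ∀ᵐ γ ∂ν, γ ∈ CurveClass.simple ∧ γ.source = D.pt 0 ∧ γ.target = D.pt 1 ∧
        γ.range ⊆ closure D.carrier ∧ γ.range ∩ frontier D.carrier ⊆ {D.pt 0, D.pt 1}

/-- At `x = x_c` the family member is the crux (`lawAt x_c = law` definitionally).
[cite: DuminilCopinKozmaYadin2014, §1 (x_c = 1/μ)] -/
theorem simpleSubseqLimitsAt_criticalFugacity :
    SimpleSubseqLimitsAt criticalFugacity ↔ SimpleSubseqLimits :=
  Iff.rfl

/-- The parameter-`x` law has total mass `≤ 1` on every event (normalised weight, junk `0`).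
[folklore] -/
theorem lawAt_apply_le_one (x : ℝ) (Ω : Set ℂ) (δ : ℝ) (a b : Site 2)
    (S : Set (DomainSAW Ω δ a b)) : lawAt x Ω δ a b S ≤ 1 := by
  rw [lawAt, Measure.smul_apply, smul_eq_mul]
  exact (mul_le_mul' le_rfl (measure_mono (μ := weightAt x Ω δ a b) (subset_univ S))).trans
    (ENNReal.inv_mul_le_one _)

/-- The parameter-`x` law is a finite measure. [folklore] -/
instance isFiniteMeasure_lawAt (x : ℝ) (Ω : Set ℂ) (δ : ℝ) (a b : Site 2) :
    IsFiniteMeasure (lawAt x Ω δ a b) :=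
  ⟨(lawAt_apply_le_one x Ω δ a b univ).trans_lt ENNReal.one_lt_top⟩

/-- Reindexing a sequence of meshes as a mesh family: `δ ↦ ⌊δ⁻¹⌋₊ → ∞` as `δ → 0⁺`. [folklore] -/
theorem tendsto_floor_inv_atTop : Tendsto (fun δ : ℝ => ⌊δ⁻¹⌋₊) (𝓝[>] (0 : ℝ)) atTop :=
  tendsto_nat_floor_atTop.comp tendsto_inv_nhdsGT_zero

/-- **Supercritical subsequential limits are ONTO the disc.** For `x > x_c`, in `(𝔻; 1, -1)` with
closest-site endpoints, every probability measure `ν` that is the weak limit of the parameter-`x`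
SAW laws along some `s n → 0⁺` is carried by curves whose trace contains the open unit disc.
[cite: DuminilCopinKozmaYadin2014, Theorem 1] -/
theorem ae_unitDisk_subset_range_of_supercritical_weakLimit {x : ℝ} (hx : criticalFugacity < x)
    {A B : ℝ → Site 2}
    (hAB : ∀ δ : ℝ, 0 < δ → IsClosestSite unitDisk δ 1 (A δ) ∧ IsClosestSite unitDisk δ (-1) (B δ))
    {s : ℕ → ℝ} (hs : Tendsto s atTop (𝓝[>] (0 : ℝ))) {ν : Measure (CurveClass ℂ)}
    [IsProbabilityMeasure ν]
    (hw : ∀ f : CurveClass ℂ →ᵇ ℝ,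
      Tendsto (fun n => ∫ γ, f γ.curve ∂(lawAt x unitDisk (s n) (A (s n)) (B (s n)))) atTop
        (𝓝 (∫ x, f x ∂ν))) :
    ∀ᵐ γ ∂ν, unitDisk ⊆ γ.range := by
  have hne : (1 : ℂ) ≠ -1 := fun h => by
    have h' := congrArg Complex.re h
    norm_num at h'
  have hfill : IsSpaceFillingLaws DobrushinDomain.unitDisc.carrier A B
      (fun δ => lawAt x DobrushinDomain.unitDisc.carrier δ (A δ) (B δ)) :=
    isSpaceFillingLaws_lawAt_iff.2
      (isSpaceFillingFamily_of_DKY2014_thm1 DKY2014_thm1_holds (by simp) (by simp) hne hAB hx)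
  let N : ℝ → ℕ := fun δ => ⌊δ⁻¹⌋₊
  let m : ℝ → ℝ := fun δ => s (N δ)
  have hm : Tendsto m (𝓝[>] (0 : ℝ)) (𝓝[>] (0 : ℝ)) := hs.comp tendsto_floor_inv_atTop
  let X : ∀ δ : ℝ, DomainSAW unitDisk (m δ) (A (m δ)) (B (m δ)) → CurveClass ℂ :=
    fun δ γ => γ.curve
  let P : ∀ δ : ℝ, Measure (DomainSAW unitDisk (m δ) (A (m δ)) (B (m δ))) :=
    fun δ => lawAt x unitDisk (m δ) (A (m δ)) (B (m δ))
  have hT : TendstoLaw X P id ν := fun f => (hw f).comp tendsto_floor_inv_atTop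
  refine ae_subset_range_of_tendstoLaw (X := X) (P := P) (Γ := id) (W := ν)
    (fun _ => DomainSAW.measurable_of_top _) aemeasurable_id hT Metric.isOpen_ball ?_
  intro z r hr hball
  exact (hfill.tendsto_measure_disjoint_ball hr hball).comp hm

/-- Hence **no supercritical subsequential limit is carried by simple curves** (a simple curve
covers no open set). [cite: DuminilCopinKozmaYadin2014, Theorem 1] -/
theorem not_ae_simple_of_supercritical_weakLimit {x : ℝ} (hx : criticalFugacity < x)
    {A B : ℝ → Site 2}
    (hAB : ∀ δ : ℝ, 0 < δ → IsClosestSite unitDisk δ 1 (A δ) ∧ IsClosestSite unitDisk δ (-1) (B δ))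
    {s : ℕ → ℝ} (hs : Tendsto s atTop (𝓝[>] (0 : ℝ))) {ν : Measure (CurveClass ℂ)}
    [IsProbabilityMeasure ν]
    (hw : ∀ f : CurveClass ℂ →ᵇ ℝ,
      Tendsto (fun n => ∫ γ, f γ.curve ∂(lawAt x unitDisk (s n) (A (s n)) (B (s n)))) atTop
        (𝓝 (∫ x, f x ∂ν))) :
    ¬ ∀ᵐ γ ∂ν, γ ∈ CurveClass.simple := by
  intro hsimple
  have h := ae_unitDisk_subset_range_of_supercritical_weakLimit hx hAB hs hw
  have hfalse : ∀ᵐ γ ∂ν, False := by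
    filter_upwards [hsimple, h] with γ h1 h2
    exact not_subset_range_of_mem_simple h1 Metric.isOpen_ball ⟨0, Metric.mem_ball_self one_pos⟩ h2
  rw [eventually_false_iff_eq_bot, ae_eq_bot] at hfalse
  exact IsProbabilityMeasure.ne_zero ν hfalse

/-- **CRITICALITY IS LOAD-BEARING (modulo existence of limits).** For every `x > x_c`: if the
parameter-`x` SAW in `(𝔻; 1, -1)` with closest-site endpoints has ANY subsequential weak limit
(e.g. if its laws are tight — expected, the conjectural limit being SLE₈), then the crux at
fugacity `x` is FALSE. [cite: DuminilCopinKozmaYadin2014, Theorem 1] -/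
theorem simpleSubseqLimitsAt_false_of_supercritical_limit {x : ℝ} (hx : criticalFugacity < x)
    (h : ∃ (A B : ℝ → Site 2) (s : ℕ → ℝ) (ν : Measure (CurveClass ℂ)),
      (∀ δ : ℝ, 0 < δ → IsClosestSite unitDisk δ 1 (A δ) ∧ IsClosestSite unitDisk δ (-1) (B δ)) ∧
      Tendsto s atTop (𝓝[>] (0 : ℝ)) ∧ IsProbabilityMeasure ν ∧
      ∀ f : CurveClass ℂ →ᵇ ℝ,
        Tendsto (fun n => ∫ γ, f γ.curve ∂(lawAt x unitDisk (s n) (A (s n)) (B (s n)))) atTop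
          (𝓝 (∫ x, f x ∂ν))) :
    ¬ SimpleSubseqLimitsAt x := by
  obtain ⟨A, B, s, ν, hAB, hs, hν, hw⟩ := h
  intro hC
  have := hC DobrushinDomain.unitDisc A B (isEndpointApprox_unitDisc_of_isClosestSite hAB) s ν hs
    hν hw
  exact not_ae_simple_of_supercritical_weakLimit hx hAB hs hw (this.mono fun γ hγ => hγ.1)

/-- Unconditional reading: **at `x > x_c` the crux can hold only VACUOUSLY** — `SimpleSubseqLimitsAt x`
implies that the supercritical SAW of `(𝔻; 1, -1)` (closest sites) has no subsequential weak limit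
along any sequence of meshes. [cite: DuminilCopinKozmaYadin2014, Theorem 1] -/
theorem no_supercritical_limit_of_simpleSubseqLimitsAt {x : ℝ} (hx : criticalFugacity < x)
    (hC : SimpleSubseqLimitsAt x) {A B : ℝ → Site 2}
    (hAB : ∀ δ : ℝ, 0 < δ → IsClosestSite unitDisk δ 1 (A δ) ∧ IsClosestSite unitDisk δ (-1) (B δ))
    {s : ℕ → ℝ} (hs : Tendsto s atTop (𝓝[>] (0 : ℝ))) {ν : Measure (CurveClass ℂ)}
    [hν : IsProbabilityMeasure ν] :
    ¬ ∀ f : CurveClass ℂ →ᵇ ℝ,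
      Tendsto (fun n => ∫ γ, f γ.curve ∂(lawAt x unitDisk (s n) (A (s n)) (B (s n)))) atTop
        (𝓝 (∫ x, f x ∂ν)) := fun hw =>
  simpleSubseqLimitsAt_false_of_supercritical_limit hx ⟨A, B, s, ν, hAB, hs, hν, hw⟩ hC

end Summit.CriticalPhenomena.SAWScalingLimit.Theorems.SimpleSubseqLimits.Negative
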